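import Literature.Analysis.FluidPDE.SereginEpsilonRegularityProofs
import Literature.Analysis.FluidPDE.RusinSverakSingularityStability
import Literature.Analysis.FluidPDE.PressureDecayEstimateProofs
import Literature.Analysis.FluidPDE.CKNLocalRegularityRRSStep2
import HarnessLib

/-!
# Persistence of singularities (Albritton–Barker 2019, Prop. 2.3) from the one-scale
# ε-regularity criterion

Analysis/FluidPDE proof file (no definitions, no new named facts) in the decomposition of the
named fact `Literature.Analysis.FluidPDE.PersistenceOfSingularities` (`LocalTypeI.lean`;
D. Albritton, T. Barker, *On local Type I singularities of the Navier–Stokes equations and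
Liouville theorems*, J. Math. Fluid Mech. 21 (2019) = arXiv:1811.00502, **Proposition 2.3**
(persistence of singularities): if suitable weak solutions `(v^{(k)}, q^{(k)})` on `Q = Q(0, 1)`,
bounded in `L³ × L^{3/2}(Q)` and converging to `(u, p)` as in Lemma 2.2, satisfy
`limsup_k ‖v^{(k)}‖_{L^∞(Q(R))} = ∞` for every `0 < R < 1`, then `u` is singular at the space–time
origin; "contained in Lemma 2.1 and Lemma 2.2 of [Rusin–Šverák 2011]").

Main results:

* `PersistenceOfSingularities_of_unforced` — Prop. 2.3 from an *unforced quantitative one-scale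
  ε-regularity criterion on backward cylinders inside the domain* (the shape proved in
  `CKNUnforcedOneScaleRRS.lean` from Robinson–Rodrigo–Sadowski's Thm. 15.3: for data satisfying
  the §14.3 hypotheses of Lemarié-Rieusset with `ν = 1`, `f = 0` on `Ω` and a cylinder
  `Q_{r₀}(z₀) ⊆ Ω` — open inclusion, so `z₀` may be the vertex of `Ω` —,
  `∫∫_{Q_{r₀}(z₀)} (|u|³ + |p|^{3/2}) ≤ λ³ r₀²`, `λ ≤ ε₀`, gives `|u| ≤ C₀ λ / r₀` a.e. on
  `Q_{r₀/2}(z₀)`);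
* `PersistenceOfSingularities_of_theorem15_3 : RRS2016.theorem15_3 → PersistenceOfSingularities`;
* `PersistenceOfSingularities_of_lemma15_12 : RRS2016.lemma15_12 → PersistenceOfSingularities` —
  after `CKNLocalRegularityRRSStep2.lean` (`RRS2016.theorem15_3_of_lemma15_12`) the local pressure
  estimate, Robinson–Rodrigo–Sadowski's Lemma 15.12, is the only undischarged leaf below
  Prop. 2.3.

## The printed proof and the proof given here

Albritton–Barker (arXiv:1811.00502, p. 5) prove the contrapositive: if `u ∈ L^∞(Q(R))` for some
`0 < R < 1`, then `r⁻² ∫_{Q(r)} |u|³ ≤ ε` for small `r` ("a subcritical assumption"), hence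
`r⁻² ∫_{Q(r)} |v^{(k)}|³ ≤ 2ε` for large `k` by the strong `L³` convergence; the pressure is split
as `q^{(k)} = q̃^{(k)} + h^{(k)}`, `q̃^{(k)} = (-Δ)⁻¹ div div(φ v^{(k)} ⊗ v^{(k)})` (Calderón–Zygmund)
and `h^{(k)}` harmonic in `x` (interior estimates, bounded through the uniform `L³ × L^{3/2}`
bound), so that `limsup_k r⁻² ∫_{Q(r)} |v^{(k)}|³ + |q^{(k)}|^{3/2} ≤ ε_CKN` for `r` small, and
"this ensures `limsup_k sup_{Q(r/2)} |v^{(k)}| ≤ C_CKN / r`" — the **quantitative** ε-regularity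
criterion of Caffarelli–Kohn–Nirenberg at the cylinders `Q(r) = Q(0, r)`, which share their
vertex with `Q`.

The proof below is this argument with the harmonic bookkeeping packaged, exactly as in the
tree's proof of Rusin–Šverák's Lemma 2.1 (`rusin_sverak_stability_of_singularities_of_unforced`,
`RusinSverakSingularityStability.lean`), in the **proved** pressure decay estimate
`seregin_sverak_pressure_decay_holds` (Seregin–Šverák 2009, (as13):
`D(θr) ≤ c (θ D(r) + θ⁻² C(r))`, valid on every cylinder `Q_r(z) ⊆ Ω`, open inclusion) iterated
along the scales `θʲ r₀` at the fixed centre `0`: if `|u| ≤ M` a.e. on `Q(0, r₁)`, then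
`C_k(θʲ r₀) ≤ 4 |B₁| M³ r₀³ + 4 s⁻² ∫_{Q(0,r₁)} |v^{(k)} - u|³` for `j ≤ J`, `s = θᴶ r₀`
(`cknC_le_of_ae_bound_of_lintegral_sub`), `D_k(s) ≤ 2^{-J} r₀⁻² sup_l ∫_Q |q^{(l)}|^{3/2} + 2cθ⁻² e_k`
(`cknD_iterate_le_of_pressure_decay`); choosing `r₀`, then `J`, then `k` large,
`C_k(s) + D_k(s) ≤ ε₀³`, and the quantitative criterion, applied to the approximant `(v^{(k)}, q^{(k)})`
on `Ω = Q(0, 1)` (its §14.3 classes are the global classes of Def. 2.1,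
`IsSuitableWeakSolutionInBall.exists_isLRSuitableWeakSolutionOn`), bounds `|v^{(k)}| ≤ C₀ ε₀ / s`
a.e. on `Q(0, s/2)` for all large `k` — so `limsup_k ‖v^{(k)}‖_{L^∞(Q(s/2))} ≤ C₀ ε₀ / s < ∞`,
contradicting the hypothesis at `R = s/2`. Only the bound `|u| ≤ M`, the strong `L³` convergence
of the velocities and the uniform `L^{3/2}(Q)` bound of the pressures are used (not the weak
convergence of the pressures, nor the equations for the limit).

## Mathlib / tree search

Tree (all used): `cknC_le_of_ae_bound_of_lintegral_sub` (`RusinSverakSingularityStability.lean`);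
`cknD_iterate_le_of_pressure_decay`, `exists_ratio_mul_le_half`, `ae_enorm_le_eLpNorm_top`,
`exists_forall_ofReal_pow_three_mul_le`, `ENNReal.add_quarters_le`
(`RusinSverakBackwardRegularity.lean`); `seregin_sverak_pressure_decay_holds` and `.ratio`
(`PressureDecayEstimate(Proofs).lean`); `unforced_epsilonRegularity_of_theorem15_3`
(`CKNUnforcedOneScaleRRS.lean`); `IsSuitableWeakSolutionInBall.exists_isLRSuitableWeakSolutionOn`,
`setLIntegral_cubic_add_pressure_le_of_cknC_add_cknD_le` (`SereginEpsilonRegularityProofs.lean`);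
`RRS2016.theorem15_3_of_lemma15_12` (`CKNLocalRegularityRRSStep2.lean`); `parabolicCylinder_mono`,
`exists_inv_two_pow_mul_le` (`CKN1982Setting.lean`); `cknD_le_of_subset`
(`CKNEpsilonRegularityAssembly.lean`). `lean search PersistenceOfSingularities`: the fact, its two
consumers (`LocalTypeIReverse.lean`, `LocalTypeICharacterization.lean`), no proof. Mathlib:
`eLpNorm_eq_lintegral_rpow_enorm_toReal`, `Filter.Tendsto.ennrpow_const`,
`eLpNormEssSup_le_of_ae_bound`, `Filter.limsup_le_of_le`.

## References

* D. Albritton, T. Barker, J. Math. Fluid Mech. 21 (2019) = arXiv:1811.00502, Prop. 2.3 and its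
  proof (p. 5 of the arXiv version). [AlbrittonBarker2019]
* W. Rusin, V. Šverák, J. Funct. Anal. 260 (2011) = arXiv:0911.0500, Lemmas 2.1–2.2 and the proof
  of Lemma 2.1 (p. 4). [RusinSverak2011]
* G. Seregin, V. Šverák, Comm. PDE 34 (2009) = arXiv:0804.1803, proof of Lemma 3.5, (as13).
  [SereginSverak2009]
* J. C. Robinson, J. L. Rodrigo, W. Sadowski, *The three-dimensional Navier–Stokes equations*,
  CUP (2016), Thm. 15.3, Lemma 15.12. [RobinsonRodrigoSadowski2016]
* L. Caffarelli, R. Kohn, L. Nirenberg, Comm. Pure Appl. Math. 35 (1982), Prop. 1 and Corollary.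
  [CaffarelliKohnNirenberg1982]
-/

noncomputable section

open MeasureTheory Set Function Filter Topology TopologicalSpace Metric
open scoped NNReal ENNReal

namespace Literature.Analysis.FluidPDE

/-! ### From the `eLpNorm` hypotheses of Prop. 2.3 to plain integrals -/

/-- `∫ |q|^{3/2} = ‖q‖_{L^{3/2}}^{3/2}`, as a bound: `‖q‖_{L^{3/2}(μ)} ≤ B` gives
`∫ |q|^{3/2} dμ ≤ B^{3/2}`. [folklore] -/
theorem lintegral_rpow_threeHalves_le_of_eLpNorm_le {α : Type*} [MeasurableSpace α]
    {μ : Measure α} {f : α → ℝ} {B : ℝ≥0∞} (h : eLpNorm f (3 / 2) μ ≤ B) :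
    ∫⁻ x, ‖f x‖ₑ ^ (3 / 2 : ℝ) ∂μ ≤ B ^ (3 / 2 : ℝ) := by
  have e32 : ((3 : ℝ≥0∞) / 2).toReal = (3 / 2 : ℝ) := by
    rw [ENNReal.toReal_div, ENNReal.toReal_ofNat, ENNReal.toReal_ofNat]
  have h1 : (∫⁻ x, ‖f x‖ₑ ^ (3 / 2 : ℝ) ∂μ) = eLpNorm f (3 / 2) μ ^ (3 / 2 : ℝ) := by
    rw [eLpNorm_eq_lintegral_rpow_enorm_toReal (by norm_num) (by simp [ENNReal.div_eq_top]), e32,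
      ← ENNReal.rpow_mul]
    norm_num
  rw [h1]
  exact ENNReal.rpow_le_rpow h (by norm_num)

/-- Strong `L³` convergence in the `eLpNorm` form of Prop. 2.3 gives `∫∫_K |v_k - u|³ → 0`.
[folklore] -/
theorem tendsto_lintegral_cube_of_tendsto_eLpNorm {K : Set (ℝ × EuclideanSpace ℝ (Fin 3))}
    {v : ℕ → ℝ → EuclideanSpace ℝ (Fin 3) → EuclideanSpace ℝ (Fin 3)}
    {u : ℝ → EuclideanSpace ℝ (Fin 3) → EuclideanSpace ℝ (Fin 3)}
    (h : Tendsto (fun k => eLpNorm (uncurry (v k) - uncurry u) 3 (volume.restrict K))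
      atTop (𝓝 0)) :
    Tendsto (fun k => ∫⁻ w in K, ‖v k w.1 w.2 - u w.1 w.2‖ₑ ^ (3 : ℕ)) atTop (𝓝 0) := by
  have h3 := h.ennrpow_const 3
  rw [ENNReal.zero_rpow_of_pos (by norm_num : (0 : ℝ) < 3)] at h3
  refine h3.congr fun k => ?_
  rw [eLpNorm_eq_lintegral_rpow_enorm_toReal (by norm_num) (by norm_num), ENNReal.toReal_ofNat,
    ← ENNReal.rpow_mul, show (1 / (3 : ℝ)) * 3 = 1 by norm_num, ENNReal.rpow_one]
  refine lintegral_congr fun w => ?_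
  show ‖v k w.1 w.2 - u w.1 w.2‖ₑ ^ (3 : ℝ) = ‖v k w.1 w.2 - u w.1 w.2‖ₑ ^ (3 : ℕ)
  rw [← ENNReal.rpow_natCast]
  norm_num

/-! ### Prop. 2.3 from the unforced quantitative one-scale criterion -/

/-- **Albritton–Barker's Prop. 2.3 from an unforced quantitative one-scale ε-regularity
criterion** (the shape of `unforced_epsilonRegularity_of_theorem15_3`: `ε₀, C₀ > 0` such that for
data satisfying Lemarié-Rieusset's §14.3 hypotheses with `ν = 1`, `f = 0` on `Ω`, every cylinder
`Q_{r₀}(z₀) ⊆ Ω` and `0 ≤ λ ≤ ε₀`, `∫∫_{Q_{r₀}(z₀)} (|u|³ + |p|^{3/2}) ≤ λ³ r₀²` implies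
`|u| ≤ C₀ λ / r₀` a.e. on `Q_{r₀/2}(z₀)`). Proof: module docstring — the contrapositive, as printed:
boundedness of `u` on `Q(0, r₁)` and the strong `L³` convergence make the cubic quantities of the
approximants small at the scales `θʲ r₀` (`cknC_le_of_ae_bound_of_lintegral_sub`), the proved
pressure decay estimate iterated `J` times makes `D_k(θᴶ r₀)` small uniformly in `k`
(`cknD_iterate_le_of_pressure_decay`, uniform `L^{3/2}(Q)` bound), and the criterion bounds
`|v^{(k)}| ≤ C₀ ε₀ / s` a.e. on `Q(0, s/2)`, `s = θᴶ r₀`, for all large `k`, contradicting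
`limsup_k ‖v^{(k)}‖_{L^∞(Q(s/2))} = ∞`.
[cite: AlbrittonBarker2019, Prop. 2.3 and its proof (arXiv:1811.00502 p. 5); RusinSverak2011 Lemma 2.1 and its proof (arXiv:0911.0500 p. 4)] -/
theorem PersistenceOfSingularities_of_unforced
    (hU : ∃ ε₀ C₀ : ℝ, 0 < ε₀ ∧ 0 < C₀ ∧
      ∀ (Q : Opens (ℝ × EuclideanSpace ℝ (Fin 3))) (q : ℝ)
        (u : ℝ → EuclideanSpace ℝ (Fin 3) → EuclideanSpace ℝ (Fin 3))
        (p : ℝ → EuclideanSpace ℝ (Fin 3) → ℝ)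
        (G : ℝ → EuclideanSpace ℝ (Fin 3) → EuclideanSpace ℝ (Fin 3) →L[ℝ] EuclideanSpace ℝ (Fin 3)),
        1 ≤ q → IsLRSuitableWeakSolutionOn Q 1 q 0 u p G →
        ∀ (z₀ : ℝ × EuclideanSpace ℝ (Fin 3)) (r₀ l : ℝ), 0 < r₀ →
          parabolicCylinder r₀ z₀ ⊆ (Q : Set (ℝ × EuclideanSpace ℝ (Fin 3))) → 0 ≤ l → l ≤ ε₀ →
          ∫⁻ w in parabolicCylinder r₀ z₀,
              (‖u w.1 w.2‖ₑ ^ (3 : ℕ) + ‖p w.1 w.2‖ₑ ^ (3 / 2 : ℝ)) ≤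
            ENNReal.ofReal (l ^ 3 * r₀ ^ 2) →
          ∀ᵐ w ∂(volume.restrict (parabolicCylinder (r₀ / 2) z₀)), ‖u w.1 w.2‖ ≤ C₀ * l / r₀) :
    PersistenceOfSingularities := by
  intro v q u p hball hsup hlim hblow
  by_contra hnot
  simp only [IsBackwardSingularPoint, not_forall] at hnot
  obtain ⟨ρ, hρ, hfin⟩ := hnot
  -- the cylinder `S = Q(0, r₁)`, `r₁ = min ρ (1/2)`, on which `|u| ≤ M < ∞`
  set r₁ : ℝ := min ρ (1 / 2) with hr₁def
  have hr₁ : 0 < r₁ := lt_min hρ (by norm_num)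
  have hr₁ρ : r₁ ≤ ρ := min_le_left _ _
  have hr₁h : r₁ ≤ 1 / 2 := min_le_right _ _
  have hr₁1 : r₁ < 1 := by linarith
  set S : Set (ℝ × EuclideanSpace ℝ (Fin 3)) :=
    parabolicCylinder r₁ (0 : ℝ × EuclideanSpace ℝ (Fin 3)) with hSdef
  have hSρ : S ⊆ parabolicCylinder ρ (0 : ℝ × EuclideanSpace ℝ (Fin 3)) :=
    parabolicCylinder_mono hr₁.le hr₁ρ 0
  set M : ℝ≥0∞ := eLpNorm (uncurry u) ∞ (volume.restrict S) with hMdef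
  have hMtop : M ≠ ∞ :=
    (lt_of_le_of_lt (eLpNorm_mono_measure _ (Measure.restrict_mono hSρ le_rfl))
      (lt_top_iff_ne_top.2 hfin)).ne
  have hM : ∀ᵐ w ∂(volume.restrict S), ‖u w.1 w.2‖ₑ ≤ M := ae_enorm_le_eLpNorm_top u S
  -- the domain `Ω = Q(0, 1)` of the approximants
  set O : Opens (ℝ × EuclideanSpace ℝ (Fin 3)) :=
    parabolicCylinderOpens 1 (0 : ℝ × EuclideanSpace ℝ (Fin 3)) with hOdef
  have hSO : S ⊆ (O : Set (ℝ × EuclideanSpace ℝ (Fin 3))) :=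
    parabolicCylinder_mono hr₁.le hr₁1.le 0
  -- the constants of the pressure decay estimate and of the criterion
  obtain ⟨c, hPD⟩ := seregin_sverak_pressure_decay_holds.ratio
  obtain ⟨ε₁, C₀, hε₁, hC₀, hReg⟩ := hU
  obtain ⟨θ, hθ, hθhalf, hcθ⟩ := exists_ratio_mul_le_half c
  have hθ1 : θ ≤ 1 := hθhalf.trans (by norm_num)
  -- the uniform `L^{3/2}(Q)` bound of the pressures
  set Bsup : ℝ≥0∞ := ⨆ k, (eLpNorm (uncurry (v k)) 3
      (volume.restrict (parabolicCylinder 1 (0 : ℝ × EuclideanSpace ℝ (Fin 3)))) +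
    eLpNorm (uncurry (q k)) (3 / 2)
      (volume.restrict (parabolicCylinder 1 (0 : ℝ × EuclideanSpace ℝ (Fin 3))))) with hBsup
  have hBtop : Bsup ≠ ∞ := hsup.ne
  set Cp : ℝ≥0∞ := Bsup ^ (3 / 2 : ℝ) with hCpdef
  have hCptop : Cp ≠ ∞ := ENNReal.rpow_ne_top_of_nonneg (by norm_num) hBtop
  have hCp : ∀ k, ∫⁻ w in parabolicCylinder 1 (0 : ℝ × EuclideanSpace ℝ (Fin 3)),
      ‖q k w.1 w.2‖ₑ ^ (3 / 2 : ℝ) ≤ Cp := by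
    intro k
    refine lintegral_rpow_threeHalves_le_of_eLpNorm_le (f := uncurry (q k)) ?_
    refine le_trans ?_ (le_iSup (fun k => eLpNorm (uncurry (v k)) 3
      (volume.restrict (parabolicCylinder 1 (0 : ℝ × EuclideanSpace ℝ (Fin 3)))) +
      eLpNorm (uncurry (q k)) (3 / 2)
      (volume.restrict (parabolicCylinder 1 (0 : ℝ × EuclideanSpace ℝ (Fin 3))))) k)
    exact le_add_self
  -- the strong `L³` convergence on `S`
  have hT : Tendsto (fun k => ∫⁻ w in S, ‖v k w.1 w.2 - u w.1 w.2‖ₑ ^ (3 : ℕ)) atTop (𝓝 0) :=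
    tendsto_lintegral_cube_of_tendsto_eLpNorm (hlim r₁ ⟨hr₁, hr₁1⟩).2.1
  -- constants
  set V₁ : ℝ≥0∞ := volume (ball (0 : EuclideanSpace ℝ (Fin 3)) 1) with hV₁
  have hV₁top : V₁ ≠ ∞ := measure_ball_lt_top.ne
  set Θ : ℝ≥0∞ := ENNReal.ofReal ((θ⁻¹) ^ 2) with hΘ
  set L : ℝ≥0∞ := 1 + 2 * ((c : ℝ≥0∞) * Θ) with hL
  have hLtop : L ≠ ∞ := ENNReal.add_ne_top.2 ⟨ENNReal.one_ne_top,
    ENNReal.mul_ne_top ENNReal.ofNat_ne_top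
      (ENNReal.mul_ne_top ENNReal.coe_ne_top ENNReal.ofReal_ne_top)⟩
  set ε : ℝ≥0∞ := ENNReal.ofReal (ε₁ ^ 3) with hεdef
  have hε4 : 0 < ε / 4 :=
    ENNReal.div_pos (ENNReal.ofReal_pos.2 (by positivity)).ne' ENNReal.ofNat_ne_top
  -- (A) the radius `r₀ ≤ r₁`: `L · 4 |B₁| M³ r₀³ ≤ ε/4`
  obtain ⟨rA, hrA, hA⟩ := exists_forall_ofReal_pow_three_mul_le (N := L * (4 * (V₁ * M ^ 3)))
    (ENNReal.mul_ne_top hLtop (ENNReal.mul_ne_top ENNReal.ofNat_ne_top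
      (ENNReal.mul_ne_top hV₁top (ENNReal.pow_ne_top hMtop)))) hε4
  set r₀ : ℝ := min r₁ rA with hr₀def
  have hr₀ : 0 < r₀ := lt_min hr₁ hrA
  have hr₀r₁ : r₀ ≤ r₁ := min_le_left _ _
  have hAr₀ : ENNReal.ofReal (r₀ ^ 3) * (L * (4 * (V₁ * M ^ 3))) ≤ ε / 4 :=
    hA r₀ hr₀ (min_le_right _ _)
  have hsubS₀ : parabolicCylinder r₀ (0 : ℝ × EuclideanSpace ℝ (Fin 3)) ⊆ S :=
    parabolicCylinder_mono hr₀.le hr₀r₁ 0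
  have hsubO₀ : parabolicCylinder r₀ (0 : ℝ × EuclideanSpace ℝ (Fin 3)) ⊆
      (O : Set (ℝ × EuclideanSpace ℝ (Fin 3))) := hsubS₀.trans hSO
  -- (B) the number of steps `J`
  set P : ℝ≥0∞ := (ENNReal.ofReal r₀ ^ 2)⁻¹ * Cp with hPdef
  have hPtop : P ≠ ∞ :=
    ENNReal.mul_ne_top (ENNReal.inv_ne_top.2 (pow_ne_zero 2 (ENNReal.ofReal_pos.2 hr₀).ne')) hCptop
  obtain ⟨J, hJ⟩ := exists_inv_two_pow_mul_le hPtop hε4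
  -- the final scale `s = θᴶ r₀`
  set s : ℝ := θ ^ J * r₀ with hsdef
  have hs : 0 < s := by positivity
  have hsr₀ : s ≤ r₀ := mul_le_of_le_one_left hr₀.le (pow_le_one₀ hθ.le hθ1)
  have hscale0 : ∀ j : ℕ, 0 < θ ^ j * r₀ := fun j => by positivity
  have hscale1 : ∀ j : ℕ, θ ^ j * r₀ ≤ r₀ := fun j =>
    mul_le_of_le_one_left hr₀.le (pow_le_one₀ hθ.le hθ1)
  have hscale2 : ∀ j ≤ J, s ≤ θ ^ j * r₀ := fun j hj =>
    mul_le_mul_of_nonneg_right (pow_le_pow_of_le_one hθ.le hθ1 hj) hr₀.le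
  have hsubO : parabolicCylinder s (0 : ℝ × EuclideanSpace ℝ (Fin 3)) ⊆
      (O : Set (ℝ × EuclideanSpace ℝ (Fin 3))) :=
    (parabolicCylinder_mono hs.le hsr₀ 0).trans hsubO₀
  -- large `k`: the `L³` distance on `S` is small
  have hevT : ∀ᶠ k : ℕ in atTop, L * (4 * ((ENNReal.ofReal s ^ 2)⁻¹ *
      ∫⁻ w in S, ‖v k w.1 w.2 - u w.1 w.2‖ₑ ^ (3 : ℕ))) ≤ ε / 4 := by
    have hfin : L * (4 * (ENNReal.ofReal s ^ 2)⁻¹) ≠ ∞ :=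
      ENNReal.mul_ne_top hLtop (ENNReal.mul_ne_top ENNReal.ofNat_ne_top
        (ENNReal.inv_ne_top.2 (pow_ne_zero 2 (ENNReal.ofReal_pos.2 hs).ne')))
    have h1 := ENNReal.Tendsto.const_mul hT (Or.inr hfin)
    rw [mul_zero] at h1
    have h2 : Tendsto (fun k : ℕ => L * (4 * ((ENNReal.ofReal s ^ 2)⁻¹ *
        ∫⁻ w in S, ‖v k w.1 w.2 - u w.1 w.2‖ₑ ^ (3 : ℕ)))) atTop (𝓝 0) := by
      refine h1.congr fun k => ?_
      simp only [mul_assoc]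
    exact h2.eventually (ge_mem_nhds hε4)
  -- for such `k`, `v^{(k)}` is bounded by `C₀ ε₁ / s` on `Q(0, s/2)`
  have hbd : ∀ᶠ k : ℕ in atTop, eLpNorm (uncurry (v k)) ∞
      (volume.restrict (parabolicCylinder (s / 2) (0 : ℝ × EuclideanSpace ℝ (Fin 3)))) ≤
        ENNReal.ofReal (C₀ * ε₁ / s) := by
    filter_upwards [hevT] with k hkT
    -- the cubic inputs of the approximant `v^{(k)}`
    set T : ℝ≥0∞ := ∫⁻ w in S, ‖v k w.1 w.2 - u w.1 w.2‖ₑ ^ (3 : ℕ) with hTdef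
    set e : ℝ≥0∞ := 4 * (V₁ * M ^ 3 * ENNReal.ofReal (r₀ ^ 3)) +
      4 * ((ENNReal.ofReal s ^ 2)⁻¹ * T) with hedef
    have hCe : ∀ j ≤ J, cknC (θ ^ j * r₀) (0 : ℝ × EuclideanSpace ℝ (Fin 3)) (v k) ≤ e := by
      intro j hj
      have hQS : parabolicCylinder (θ ^ j * r₀) (0 : ℝ × EuclideanSpace ℝ (Fin 3)) ⊆ S :=
        (parabolicCylinder_mono (hscale0 j).le (hscale1 j) 0).trans hsubS₀
      refine (cknC_le_of_ae_bound_of_lintegral_sub (hscale0 j) hQS hQS hM le_rfl).trans ?_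
      have h1 : ENNReal.ofReal ((θ ^ j * r₀) ^ 3) ≤ ENNReal.ofReal (r₀ ^ 3) :=
        ENNReal.ofReal_le_ofReal (pow_le_pow_left₀ (hscale0 j).le (hscale1 j) 3)
      have h2 : (ENNReal.ofReal (θ ^ j * r₀) ^ 2)⁻¹ ≤ (ENNReal.ofReal s ^ 2)⁻¹ :=
        ENNReal.inv_le_inv.2 (pow_le_pow_left' (ENNReal.ofReal_le_ofReal (hscale2 j hj)) 2)
      rw [hedef]
      gcongr
    -- the pressure of the approximant at the last scale
    have hD : cknD s (0 : ℝ × EuclideanSpace ℝ (Fin 3)) (q k) ≤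
        (2⁻¹ : ℝ≥0∞) ^ J * cknD r₀ (0 : ℝ × EuclideanSpace ℝ (Fin 3)) (q k) +
          2 * ((c : ℝ≥0∞) * Θ * e) :=
      cknD_iterate_le_of_pressure_decay hPD hθ hθ1 hcθ (hball k).1.distributional hr₀
        hsubO₀ (fun j hj => hCe j hj.le)
    have hD0 : cknD r₀ (0 : ℝ × EuclideanSpace ℝ (Fin 3)) (q k) ≤ P :=
      (cknD_le_of_subset (q k) hsubO₀).trans (mul_le_mul_right (hCp k) _)
    -- smallness at the scale `s`
    have hsmall : cknC s (0 : ℝ × EuclideanSpace ℝ (Fin 3)) (v k) +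
        cknD s (0 : ℝ × EuclideanSpace ℝ (Fin 3)) (q k) ≤ ε := by
      have h1 : cknC s (0 : ℝ × EuclideanSpace ℝ (Fin 3)) (v k) ≤ e := hCe J le_rfl
      have h2 : L * e ≤ ε / 4 + ε / 4 := by
        rw [hedef, mul_add]
        refine add_le_add ?_ hkT
        calc L * (4 * (V₁ * M ^ 3 * ENNReal.ofReal (r₀ ^ 3)))
            = ENNReal.ofReal (r₀ ^ 3) * (L * (4 * (V₁ * M ^ 3))) := by ring
          _ ≤ ε / 4 := hAr₀
      have h3 : (2⁻¹ : ℝ≥0∞) ^ J * cknD r₀ (0 : ℝ × EuclideanSpace ℝ (Fin 3)) (q k) ≤ ε / 4 :=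
        le_trans (by gcongr) hJ
      calc cknC s (0 : ℝ × EuclideanSpace ℝ (Fin 3)) (v k) +
            cknD s (0 : ℝ × EuclideanSpace ℝ (Fin 3)) (q k)
          ≤ e + ((2⁻¹ : ℝ≥0∞) ^ J * cknD r₀ (0 : ℝ × EuclideanSpace ℝ (Fin 3)) (q k) +
              2 * ((c : ℝ≥0∞) * Θ * e)) := add_le_add h1 hD
        _ = L * e + (2⁻¹ : ℝ≥0∞) ^ J * cknD r₀ (0 : ℝ × EuclideanSpace ℝ (Fin 3)) (q k) := by
            rw [hL]; ring
        _ ≤ (ε / 4 + ε / 4) + ε / 4 := add_le_add h2 h3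
        _ ≤ ε := ENNReal.add_quarters_le ε
    -- the quantitative criterion for `(v^{(k)}, q^{(k)})` on `Ω = Q(0, 1)` at the vertex
    obtain ⟨G, hS⟩ := (hball k).exists_isLRSuitableWeakSolutionOn 3
    have hum : AEMeasurable
        (fun w : ℝ × EuclideanSpace ℝ (Fin 3) => ‖v k w.1 w.2‖ₑ ^ (3 : ℕ))
        (volume.restrict (parabolicCylinder s (0 : ℝ × EuclideanSpace ℝ (Fin 3)))) :=
      ((hS.distributional.1.aestronglyMeasurable).mono_measure
        (Measure.restrict_mono hsubO le_rfl)).aemeasurable.enorm.pow_const 3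
    have hUP := setLIntegral_cubic_add_pressure_le_of_cknC_add_cknD_le hs hum hsmall
    have key := hReg O 3 (v k) (q k) G (by norm_num) hS 0 s ε₁ hs hsubO hε₁.le le_rfl hUP
    rw [eLpNorm_exponent_top]
    exact eLpNormEssSup_le_of_ae_bound key
  -- hence `limsup_k ‖v^{(k)}‖_{L^∞(Q(s/2))} < ∞`, contradicting the hypothesis at `R = s/2`
  have hls : limsup (fun k => eLpNorm (uncurry (v k)) ∞
      (volume.restrict (parabolicCylinder (s / 2) (0 : ℝ × EuclideanSpace ℝ (Fin 3))))) atTop ≤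
        ENNReal.ofReal (C₀ * ε₁ / s) :=
    limsup_le_of_le (by isBoundedDefault) hbd
  have hs1 : s / 2 < 1 := by
    have : s ≤ 1 / 2 := hsr₀.trans (hr₀r₁.trans hr₁h)
    linarith
  rw [hblow (s / 2) ⟨by positivity, hs1⟩] at hls
  exact ENNReal.ofReal_ne_top (top_le_iff.1 hls)

/-- **Albritton–Barker's Prop. 2.3 from Robinson–Rodrigo–Sadowski's Thm. 15.3** (the unforced
first local regularity theorem at unit scale, = Caffarelli–Kohn–Nirenberg's Prop. 1): the
quantitative criterion is `unforced_epsilonRegularity_of_theorem15_3`.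
[cite: AlbrittonBarker2019, Prop. 2.3; RobinsonRodrigoSadowski2016 Thm. 15.3 p. 220] -/
theorem PersistenceOfSingularities_of_theorem15_3 (h : RRS2016.theorem15_3) :
    PersistenceOfSingularities :=
  PersistenceOfSingularities_of_unforced (unforced_epsilonRegularity_of_theorem15_3 h)

/-- **Albritton–Barker's Prop. 2.3 from the local pressure estimate alone** (Robinson–Rodrigo–
Sadowski's Lemma 15.12, the named fact `RRS2016.lemma15_12`, through
`RRS2016.theorem15_3_of_lemma15_12`): after this file the trust base of
`PersistenceOfSingularities` is `{RRS2016.lemma15_12}`.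
[cite: AlbrittonBarker2019, Prop. 2.3; RobinsonRodrigoSadowski2016 Lemma 15.12 p. 232] -/
theorem PersistenceOfSingularities_of_lemma15_12 (h12 : RRS2016.lemma15_12) :
    PersistenceOfSingularities :=
  PersistenceOfSingularities_of_theorem15_3 (RRS2016.theorem15_3_of_lemma15_12 h12)

end Literature.Analysis.FluidPDE

end
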